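import Literature.AnabelianGeometry.SemiGraphs.TemperedAnabelianThm64Sub
import Literature.AnabelianGeometry.SemiGraphs.TemperedCompletionOpenSubgroups
import Literature.AnabelianGeometry.SemiGraphs.TemperedCompletionExtension

/-!
# [SemiAnbd] Theorem 6.4 — the classical rows of the sub-DAG DISCHARGED, and the sharpened assembly

Mochizuki, *Semi-graphs of anabelioids*, Publ. RIMS **42** (2006) [SemiAnbd], §6, Theorem 6.4
(Tempered Anabelian Theorem for Hyperbolic Curves over Local Fields), kurims pp. 70–71, proof p. 71.
[cite: MochizukiSemiAnbd2006, Thm 6.4 pp.70-71]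

PROOF-ONLY companion of the sub-DAG statements file `TemperedAnabelianThm64Sub.lean` (abc-iut cell,
prover abc-iut-w5-d139, node `SemiAnbd:Thm6.4`).  The three CLASSICAL rows of the cut are proved for
EVERY datum of the interface `TemperedCurve p`, by instantiating the generic lemmas over
`IsProfiniteCompletion` (`TemperedCompletionExtension.lean`, `TemperedCompletionOpenSubgroups.lean`):

* T64-L03a `completionExtends_holds : CompletionExtends X Y` ("profinite completion yields `φ̂`");
* T64-L03b `completionOpenOfDOF_holds : CompletionOpenOfDOF X Y` ("… an OPEN homomorphism");
* T64-L07 ⇐ T64-L06′ `outerDescent_of_openDenseDOFConjugator : Y.OpenDenseDOFConjugator → OuterDescent X Y`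
  ("by Lemma 6.3, (iii), we thus conclude").

Hence the SHARPENED ASSEMBLY `temperedAnabelianTheorem_of_inputs`: the typed node
`TemperedAnabelianTheorem C` follows from EXACTLY the printed inputs, each by name — T64-L01/L01b (what
the tempered-`π₁` functor gives: DFG-type, the Galois diagram; interface level), T64-L02 = Lemma 6.3
(ii) (`PiTempDFGIffDOF`), T64-L04 = [Mzk8] Thm. 1.2 (`ProfiniteAnabelianTheorem`), T64-L06′ = Lemma 6.3
(iii) at the finite étale coverings (`OpenDenseDOFConjugator`) — and its printed, origin-quantified
form `temperedAnabelianTheoremHolds_of_inputs`.  Typed ≠ proved for those inputs; nothing of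
[Mzk8]/[André] is asserted; nothing here takes a side on [IUTchIII] Cor. 3.12.
-/

noncomputable section

namespace Literature.AnabelianGeometry.SemiGraphs

namespace TemperedCurve

variable {p : ℕ} [Fact p.Prime]

/-- **T64-L03a, PROVED** ([SemiAnbd] Thm. 6.4, proof p. 71 l. 5: "profinite completion yields
`φ̂ : Π_{X_K} → Π_{Y_L}`"): every continuous `φ : Π^temp_{X_K} → Π^temp_{Y_L}` extends along the
completions — the universal property of `Π^temp_{X_K} ↪ Π_{X_K}` (`IsProfiniteCompletion.exists_extension`)
applied to `ι_Y ∘ φ` into the profinite group `Π_{Y_L}`. [cite: MochizukiSemiAnbd2006, Thm 6.4 proof p.71] -/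
theorem completionExtends_holds (X Y : TemperedCurve p) : CompletionExtends X Y := by
  intro φ
  haveI : CompactSpace Y.PiHat := Y.isProfiniteCompletion_toHat.compactSpace
  haveI : TotallyDisconnectedSpace Y.PiHat := Y.isProfiniteCompletion_toHat.totallyDisconnectedSpace
  obtain ⟨Φ, hΦ⟩ :=
    IsProfiniteCompletion.exists_extension X.isProfiniteCompletion_toHat (Y.toHat.comp φ)
  exact ⟨Φ, fun x => hΦ x⟩

/-- **T64-L03b, PROVED** ([SemiAnbd] Thm. 6.4, proof p. 71 ll. 4–5: "given a homomorphism `φ` of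
DOF-type, profinite completion yields an OPEN homomorphism `φ̂`") — instance of
`IsProfiniteCompletion.isOpen_range_of_extends`. [cite: MochizukiSemiAnbd2006, Thm 6.4 proof p.71] -/
theorem completionOpenOfDOF_holds (X Y : TemperedCurve p) : CompletionOpenOfDOF X Y :=
  fun φ Φ hΦ hφ =>
    IsProfiniteCompletion.isOpen_range_of_extends X.isProfiniteCompletion_toHat
      Y.isProfiniteCompletion_toHat φ Φ hΦ hφ

/-- **T64-L07 ⇐ T64-L06′, PROVED** ([SemiAnbd] Thm. 6.4, proof p. 71 ll. 8–11: "by Lemma 6.3, (iii),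
we thus conclude that `φ` differs from `ψ` by composition with an inner automorphism of
`Π^temp_{Y_L}`"): Lemma 6.3 (iii) at the open subgroups of finite index of `Π^temp_{Y_L}`
(`OpenDenseDOFConjugator`) implies the descent of `Π_{Y_L}`-conjugacy of DOF-type homomorphisms to
`Π^temp_{Y_L}`-conjugacy (`IsProfiniteCompletion.outer_descent_of_openDenseDOFConjugator`, with the
injectivity `Π^temp_{Y_L} ↪ Π_{Y_L}`). [cite: MochizukiSemiAnbd2006, Thm 6.4 proof p.71] -/
theorem outerDescent_of_openDenseDOFConjugator (X Y : TemperedCurve p)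
    (h : Y.OpenDenseDOFConjugator) : OuterDescent X Y := by
  intro φ ψ hφ hψ hc
  obtain ⟨c, hc⟩ := hc
  exact IsProfiniteCompletion.outer_descent_of_openDenseDOFConjugator Y.isProfiniteCompletion_toHat
    Y.toHat_injective h φ.toMonoidHom ψ.toMonoidHom hφ hψ c hc

/-- **[SemiAnbd] Theorem 6.4 from its printed inputs, by name** (sharpened assembly; p. 71): the typed
node `TemperedAnabelianTheorem C` follows from T64-L01 `GeometricIsDFG C` and T64-L01b
`GeometricIsGaloisCompatible C` (what "arises geometrically" gives — interface level), T64-L02 = Lemma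
6.3 (ii) `Y.PiTempDFGIffDOF`, T64-L04 = [Mzk8] Thm. 1.2 `ProfiniteAnabelianTheorem C`, and T64-L06′ =
Lemma 6.3 (iii) at the coverings `Y.OpenDenseDOFConjugator`; the classical rows L03a/L03b/L07 are
discharged inside.  The inputs are HYPOTHESES (typed ≠ proved; [Mzk8] Thm. 1.2 is never asserted).
[cite: MochizukiSemiAnbd2006, Thm 6.4 pp.70-71] -/
theorem temperedAnabelianTheorem_of_inputs {X Y : TemperedCurve p} (C : TemperedCurveHom p X Y)
    (h01 : GeometricIsDFG C) (h01b : GeometricIsGaloisCompatible C) (h02 : Y.PiTempDFGIffDOF)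
    (h04 : ProfiniteAnabelianTheorem C) (h06 : Y.OpenDenseDOFConjugator) :
    TemperedAnabelianTheorem C :=
  temperedAnabelianTheorem_of_steps C h01 h01b h02 (completionExtends_holds X Y)
    (completionOpenOfDOF_holds X Y) h04 (outerDescent_of_openDenseDOFConjugator X Y h06)

end TemperedCurve

namespace TemperedMorphismOrigin

variable {p : ℕ} [Fact p.Prime]

/-- **[SemiAnbd] Theorem 6.4 as printed (origin-quantified form), from its printed inputs by name**:
`Ω.TemperedAnabelianTheoremHolds` follows once, for every certified pair of hyperbolic curves with the
genuine datum `C` of dominant morphisms, the tempered-`π₁` functor satisfies T64-L01/L01b, [Mzk8] Thm.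
1.2 holds (T64-L04), and Lemma 6.3 (ii) + Lemma 6.3 (iii) at the coverings hold for `Π^temp_{Y_L}`
(T64-L02, T64-L06′).  Nothing asserted. [cite: MochizukiSemiAnbd2006, Thm 6.4 pp.70-71] -/
theorem temperedAnabelianTheoremHolds_of_inputs (Ω : TemperedMorphismOrigin p)
    (hfun : ∀ (X Y : TemperedCurve p) (C : TemperedCurveHom p X Y), Ω.IsHyperbolicCurveOrigin X →
      Ω.IsHyperbolicCurveOrigin Y → Ω.IsDomHomOrigin C →
        TemperedCurve.GeometricIsDFG C ∧ TemperedCurve.GeometricIsGaloisCompatible C ∧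
          TemperedCurve.ProfiniteAnabelianTheorem C)
    (h63 : ∀ Y : TemperedCurve p, Ω.IsHyperbolicCurveOrigin Y →
      Y.PiTempDFGIffDOF ∧ Y.OpenDenseDOFConjugator) :
    Ω.TemperedAnabelianTheoremHolds := by
  intro X Y C hX hY hC
  obtain ⟨h01, h01b, h04⟩ := hfun X Y C hX hY hC
  obtain ⟨h02, h06⟩ := h63 Y hY
  exact TemperedCurve.temperedAnabelianTheorem_of_inputs C h01 h01b h02 h04 h06

end TemperedMorphismOrigin

end Literature.AnabelianGeometry.SemiGraphs

end
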